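import Summits.Langlands.Langlands.Theorems.IrreducibilityBySelfDualityPairLBoundaryJSWhittakerSupportValue

/-!
# The value of a spread bi-`ψ`-equivariant Whittaker function on `GL_{n+1}` — last-row form

Summit `Langlands`, sub-problem `Langlands`, helper file under `Theorems/` supporting the crux
`PairLBoundaryJS` (stmt-Langlands-13622, Arthur–Clozel (1989), Ch. 3, (2.2)), line `Sketch`,
sub-goal `exists_unipotent_mul_level_of_ne_zero`, last-row companion of
`apply_eq_whittakerCharFun_mul_apply_one_of_mem_cornerGL` (`…PairLBoundaryJSWhittakerSupportValue`).

`apply_eq_whittakerCharFun_mul_apply_one_of_lastRow_sub_le`: `N = n + 1`, `W` a spread Whittaker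
function (`IsSpreadWhittaker ψ t M W`, `ψ` non-trivial on `{|x| ≤ exp(1 - c₀)}`, `M ≥ 1`, monotone
`|t_i|` with gaps `exp(M - c₀)|t_{i+1}| ≤ |t_i|`) and moreover `exp(-m₀)|t_0| ≤ exp(-M)|t_n|` (the
`hmt` inequality of the spread datum). If the last row of an arbitrary `g ∈ GL_{n+1}(F)` is
`≡ e_{n+1} (mod 𝔭^{m₀})` — `|g_{n,j} - δ_{n,j}| ≤ exp(-m₀)` for all `j`, exactly the congruence the
thin test function pins at a thin place (`thinTestFun_ne_zero_valued_sub_le`) — and `W(g) ≠ 0`, then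
`g = u k` with `u ∈ N_{n+1}(F)`, `k ∈ GL_{n+1}(𝒪) ∩ diag(t) K(𝔭^M) diag(t)⁻¹` (the two inequality
families of `IsSpreadWhittaker.level`) and `W(g) = ψ_N(u) W(1)`. Unlike the tree's
`valuation_eq_of_glDiagonal_mul_ne_zero` (last row only `(0, …, 0, *)`), no central character /
central insensitivity of `W` is needed: the corner entry is pinned too. Proof: the row matrix
`κ = 1 + e_n ⊗ (g_{n,·} - e_n)` lies in the level group (by the `m₀`-inequality) and in
`GL_{n+1}(𝒪)`; `g κ⁻¹` has last row `e_n`, so splits as (column unipotent) × (corner `GL_n`)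
(`exists_colGL_mul_of_row_eq`), and the corner theorem `exists_unipotent_mul_level_of_ne_zero`
applies. Purely local; all proofs complete, no named fact.

## References

* H. Jacquet, I. I. Piatetski-Shapiro, J. A. Shalika, *Rankin–Selberg convolutions*, Amer. J. Math.
  105 (1983), §2, (2.7) [JacquetPiatetskiShapiroShalika1983].
-/

noncomputable section

-- `Summit.Langlands.Langlands.…` (summit = sub-problem name, D-0017 layout) trips `dupNamespace`
set_option linter.dupNamespace false

open scoped MatrixGroups
open Matrix WithZero
open Literature.NumberTheory.Automorphic Literature.NumberTheory.Automorphic.WhittakerSupport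

namespace Summit.Langlands.Langlands.Theorems.WhittakerSupportValue

variable {F : Type*} [Field F] [Valued F ℤᵐ⁰]

local notation "𝓋" => (Valued.v : Valuation F ℤᵐ⁰)

/-- **Last-row form of the value theorem** (`N = n + 1`). Hypotheses on `ψ`, `M`, `t`, `W` as in
`exists_unipotent_mul_level_of_ne_zero`, and `exp(-m₀)|t_0| ≤ exp(-M)|t_n|`. If the last row of
`g ∈ GL_{n+1}(F)` satisfies `|g_{n,j} - δ_{n,j}| ≤ exp(-m₀)` for all `j` and `W(g) ≠ 0`, then
`g = u k` with `u ∈ N_{n+1}(F)`, `k ∈ GL_{n+1}(𝒪)`, `|(k^{±1} - 1)_{ij} t_j| ≤ exp(-M)|t_i|`, and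
`W(g) = ψ_N(u) W(1)`. [folklore] -/
theorem apply_eq_whittakerCharFun_mul_apply_one_of_lastRow_sub_le :
    ∀ {n : ℕ} (ψ : AddChar F Circle) {c₀ M : ℤ}, (∃ x : F, Valued.v x ≤ exp (1 - c₀) ∧ ψ x ≠ 1) →
      1 ≤ M → ∀ {t : Fin (n + 1) → Fˣ},
      (∀ i j : Fin (n + 1), i ≤ j → Valued.v (t j : F) ≤ Valued.v (t i : F)) →
      (∀ i j : Fin (n + 1), (i : ℕ) + 1 = j → exp (M - c₀) * Valued.v (t j : F) ≤ Valued.v (t i : F)) →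
      ∀ {W : GL (Fin (n + 1)) F → ℂ}, IsSpreadWhittaker ψ t M W →
      ∀ {m₀ : ℤ}, exp (-m₀) * Valued.v (t 0 : F) ≤ exp (-M) * Valued.v (t (Fin.last n) : F) →
      ∀ {g : GL (Fin (n + 1)) F},
        (∀ j : Fin (n + 1), Valued.v ((g : Matrix (Fin (n + 1)) (Fin (n + 1)) F) (Fin.last n) j -
          if j = Fin.last n then 1 else 0) ≤ exp (-m₀)) →
        W g ≠ 0 →
        ∃ (u : GL (Fin (n + 1)) F) (hu : u ∈ upperUnitriangular (Fin (n + 1)) F)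
          (k : GL (Fin (n + 1)) F),
          k ∈ valuedCongruenceSubgroup (Fin (n + 1)) (1 : ℤᵐ⁰) ∧
          (∀ i j, Valued.v (((k : Matrix (Fin (n + 1)) (Fin (n + 1)) F) - 1) i j * t j) ≤
            exp (-M) * Valued.v (t i : F)) ∧
          (∀ i j, Valued.v ((((k⁻¹ : GL (Fin (n + 1)) F) : Matrix (Fin (n + 1)) (Fin (n + 1)) F) - 1) i j
            * t j) ≤ exp (-M) * Valued.v (t i : F)) ∧
          g = u * k ∧ W g = whittakerCharFun ψ ⟨u, hu⟩ * W 1 := by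
  intro n ψ c₀ M hψ hM₁ t hmono hgap W hW m₀ hm₀ g hlast hne
  set L : Fin (n + 1) := Fin.last n with hL
  have ht0 : ∀ i, 𝓋 (t i : F) ≠ 0 := fun i => (Valuation.ne_zero_iff _).2 (t i).ne_zero
  have hexpM1 : exp (-M) < (1 : ℤᵐ⁰) := by rw [← exp_zero, exp_lt_exp]; omega
  -- `exp(-m₀) ≤ exp(-M) < 1`
  have hm₀M : exp (-m₀) ≤ exp (-M) := by
    have h : exp (-m₀) * 𝓋 (t 0 : F) ≤ exp (-M) * 𝓋 (t 0 : F) :=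
      hm₀.trans (mul_le_mul_right (hmono 0 L (Fin.zero_le _)) _)
    exact le_of_mul_le_mul_right h (zero_lt_iff.mpr (ht0 0))
  have hm₀1 : exp (-m₀) < (1 : ℤᵐ⁰) := hm₀M.trans_lt hexpM1
  -- the deviation of the last row of `g` from `e_n`
  set D' : Fin (n + 1) → F := fun m => (g : Matrix (Fin (n + 1)) (Fin (n + 1)) F) L m -
    if L = m then 1 else 0 with hD'
  have hD'v : ∀ m, 𝓋 (D' m) ≤ exp (-m₀) := by
    intro m
    have h := hlast m
    by_cases hm : m = L
    · rw [if_pos hm] at h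
      simp only [hD']
      rw [if_pos hm.symm]
      exact h
    · rw [if_neg hm] at h
      simp only [hD']
      rw [if_neg (Ne.symm hm)]
      exact h
  have hD'1 : ∀ m, 𝓋 (D' m) ≤ 1 := fun m => (hD'v m).trans hm₀1.le
  have hvLL : 𝓋 (1 + D' L) = 1 := Valuation.map_one_add_of_lt _ ((hD'v L).trans_lt hm₀1)
  have hκ1 : 1 + D' L ≠ 0 := fun h => by rw [h, Valuation.map_zero] at hvLL; exact zero_ne_one hvLL
  -- the row matrix `κ = 1 + e_n ⊗ D'`
  set κ : GL (Fin (n + 1)) F := rowGL D' L hκ1 with hκ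
  have hκapply := rowGL_apply D' L hκ1
  have hκlevel : ∀ l m : Fin (n + 1),
      𝓋 ((((κ : GL (Fin (n + 1)) F) : Matrix (Fin (n + 1)) (Fin (n + 1)) F) - 1) l m * t m) ≤
        exp (-M) * 𝓋 (t l : F) := by
    intro l m
    rw [Matrix.sub_apply, hκapply, Matrix.one_apply, add_sub_cancel_left]
    by_cases hl : l = L
    · rw [if_pos hl, hl, Valuation.map_mul]
      calc 𝓋 (D' m) * 𝓋 (t m : F) ≤ exp (-m₀) * 𝓋 (t 0 : F) :=
            mul_le_mul' (hD'v m) (hmono 0 m (Fin.zero_le _))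
        _ ≤ exp (-M) * 𝓋 (t L : F) := hm₀
    · rw [if_neg hl, zero_mul, Valuation.map_zero]
      exact zero_le
  have hκlevel' : ∀ l m : Fin (n + 1),
      𝓋 ((((κ⁻¹ : GL (Fin (n + 1)) F) : Matrix (Fin (n + 1)) (Fin (n + 1)) F) - 1) l m * t m) ≤
        exp (-M) * 𝓋 (t l : F) := by
    intro l m
    rw [Matrix.sub_apply, hκ, rowGL_inv_apply, Matrix.one_apply, add_sub_cancel_left]
    by_cases hl : l = L
    · rw [if_pos hl, hl, Valuation.map_mul, Valuation.map_mul, Valuation.map_neg, map_inv₀, hvLL,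
        inv_one, one_mul]
      calc 𝓋 (D' m) * 𝓋 (t m : F) ≤ exp (-m₀) * 𝓋 (t 0 : F) :=
            mul_le_mul' (hD'v m) (hmono 0 m (Fin.zero_le _))
        _ ≤ exp (-M) * 𝓋 (t L : F) := hm₀
    · rw [if_neg hl, zero_mul, Valuation.map_zero]
      exact zero_le
  have hκΛ : (glDiagonal (n + 1) F t)⁻¹ * κ * glDiagonal (n + 1) F t ∈
      valuedCongruenceSubgroup (Fin (n + 1)) (exp (-M)) :=
    conj_mem_valuedCongruenceSubgroup_of_level (by omega) hκlevel hκlevel'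
  have hκK : κ ∈ valuedCongruenceSubgroup (Fin (n + 1)) (1 : ℤᵐ⁰) := by
    refine ⟨fun l m => ?_, fun l m => ?_, fun l m => ?_⟩
    · rw [hκapply]
      refine Valuation.map_add_le _ ?_ ?_
      · split_ifs <;> simp
      · split_ifs
        · exact hD'1 m
        · simp
    · rw [hκ, rowGL_inv_apply]
      refine Valuation.map_add_le _ ?_ ?_
      · split_ifs <;> simp
      · split_ifs
        · rw [Valuation.map_mul, Valuation.map_neg, map_inv₀, hvLL, inv_one, one_mul]
          exact hD'1 m
        · simp
    · rw [Matrix.sub_apply, hκapply, Matrix.one_apply, add_sub_cancel_left]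
      split_ifs
      · exact hD'1 m
      · simp
  -- `p = g κ⁻¹`: unit last row, `W p ≠ 0`
  have hprow : ∀ m : Fin (n + 1), ((g * κ⁻¹ : GL (Fin (n + 1)) F) : Matrix (Fin (n + 1)) (Fin (n + 1)) F) L m
      = if L = m then 1 else 0 := by
    intro m
    have hrowκ : ∀ x : Fin (n + 1), (g : Matrix (Fin (n + 1)) (Fin (n + 1)) F) L x =
        ((κ : GL (Fin (n + 1)) F) : Matrix (Fin (n + 1)) (Fin (n + 1)) F) L x := by
      intro x
      rw [hκapply, if_pos rfl]
      simp only [hD']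
      ring
    rw [Units.val_mul, Matrix.mul_apply]
    simp_rw [hrowκ]
    rw [← Matrix.mul_apply, ← Units.val_mul, mul_inv_cancel, Units.val_one, Matrix.one_apply]
  have hWp : W (g * κ⁻¹) ≠ 0 := by
    have h := hW.level κ hκlevel hκlevel' (g * κ⁻¹)
    rw [inv_mul_cancel_right] at h
    rwa [h] at hne
  have hp : g * κ⁻¹ ∈ cornerGL (n + 1) F (n + 1) := by
    intro l m hlm
    exfalso
    rcases hlm with h | h
    · exact absurd l.2 (not_lt.2 h)
    · exact absurd m.2 (not_lt.2 h)
  -- split off the corner `GL_n` and apply the corner theorem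
  obtain ⟨b, hb, c, hc, hpc⟩ := exists_colGL_mul_of_row_eq L rfl hp hprow
  have hWc : W c ≠ 0 := by
    have h := hW.left (colGL b L (hb _ le_rfl)) (colGL_mem_upperUnitriangular b L hb) c
    rw [← hpc] at h
    intro h0
    rw [h0, mul_zero] at h
    exact hWp h
  obtain ⟨u', hu', k', hk', hk'Λ, hck⟩ :=
    exists_unipotent_mul_level_of_ne_zero ψ hψ hM₁ hmono hgap hW (Nat.lt_succ_self n) hc hWc
  have hΛ : (glDiagonal (n + 1) F t)⁻¹ * (k' * κ) * glDiagonal (n + 1) F t ∈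
      valuedCongruenceSubgroup (Fin (n + 1)) (exp (-M)) := by
    rw [show (glDiagonal (n + 1) F t)⁻¹ * (k' * κ) * glDiagonal (n + 1) F t =
      (glDiagonal (n + 1) F t)⁻¹ * k' * glDiagonal (n + 1) F t *
        ((glDiagonal (n + 1) F t)⁻¹ * κ * glDiagonal (n + 1) F t) by group]
    exact mul_mem hk'Λ hκΛ
  have hgeq : g = colGL b L (hb _ le_rfl) * u' * (k' * κ) := by
    calc g = g * κ⁻¹ * κ := by rw [inv_mul_cancel_right]
      _ = colGL b L (hb _ le_rfl) * c * κ := by rw [hpc]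
      _ = colGL b L (hb _ le_rfl) * u' * (k' * κ) := by rw [hck]; simp only [mul_assoc]
  obtain ⟨h1, h2⟩ := level_of_conj_mem_valuedCongruenceSubgroup hΛ
  have hu : colGL b L (hb _ le_rfl) * u' ∈ upperUnitriangular (Fin (n + 1)) F :=
    mul_mem (colGL_mem_upperUnitriangular b L hb) hu'
  refine ⟨colGL b L (hb _ le_rfl) * u', hu, k' * κ, mul_mem hk' hκK, h1, h2, hgeq, ?_⟩
  rw [hgeq]
  exact apply_mul_eq_whittakerCharFun_mul_apply_one hW hu hΛ

end Summit.Langlands.Langlands.Theorems.WhittakerSupportValue
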